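import HarnessLib
import Summits.CriticalPhenomena.Ising3DConformalLimit.Theorems.HyperoctahedralRPExistsScaleCovariantLimitDoublingOfDyadicPairRatio

/-!
# Vague asymptotic isotropy of the critical `ℤ³` two-point function, XXVIII-W:
# RAY REGULAR VARIATION — the window `1 ≤ a ≤ 2`
(route HarmonicMomentsIsotropy, support item stmt-CriticalPhenomena-6036 `TwoPointAsymptoticIsotropy`;
ray-regular-variation line of seat c4)

Write `G = criticalTwoPoint 3`, `g(m) = G(m e₀)`. RAY REGULAR VARIATION with exponent `a` is the purely
radial hypothesis `RayRV[a]`: for every lattice direction `x ∈ ℤ³ ∖ {0}` and every `k ≥ 1`,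
`G(k m x) / G(m x) → k^{-a}` as `m → ∞`. This file proves `exponent_mem_Icc_of_rayRV`: `1 ≤ a ≤ 2`,
i.e. `Δ = a/2` lies in the rigorous window `[1/2, 1]` — iterating the axis doubling ratio
`g(2m)/g(m) → 2^{-a}` from one large scale `N` gives `g(2^j N) ≷ q^j g(N)`, which the two-point window
`c m⁻² ≤ g(m) ≤ C m⁻¹` (`criticalTwoPoint_bounds_holds`: Simon–Lieb lower bound, infrared upper bound)
caps at `2q ≤ 1 ≤ 4q`. It is the `1/2 ≤ Δ ≤ 1` input of nine-mirror RP rigidity (`HRP2Rigidity_of`)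
for the kernels of cluster points in the ray-regular-variation line.

References: H. Duminil-Copin, ICM 2022, §8.1 [DuminilCopinICM2022]; B. Simon, Comm. Math. Phys. 77
(1980) Thm. 1; J. Fröhlich, B. Simon, T. Spencer, Comm. Math. Phys. 50 (1976). No definitions are
introduced (`RayRV[a]` is a local notation).
-/

noncomputable section

namespace Summit.CriticalPhenomena.Ising3DConformalLimit.HarmonicMomentsIsotropyTwoPoint.RayRV

open Literature.Probability.LatticeModels Filter Set
open scoped Topology
open Summit.CriticalPhenomena.Ising3DConformalLimit.Cruxes.ExistsScaleCovariantLimit.TwoHierarchies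
  (criticalTwoPoint_axis_sq_lower)

/-- `RayRV[a]`: RAY REGULAR VARIATION of the critical two-point function with exponent `a` — on every
lattice ray `ℕ·x`, `x ∈ ℤ³ ∖ {0}`, `⟨σ₀σ_{kmx}⟩_{β_c} / ⟨σ₀σ_{mx}⟩_{β_c} → k^{-a}` as `m → ∞`, for every
`k ≥ 1` (local notation, no new definition). -/
local notation3 (prettyPrint := false) "RayRV[" a "]" =>
  ∀ x : Site 3, x ≠ 0 → ∀ k : ℕ, 1 ≤ k →
    Tendsto (fun m : ℕ => criticalTwoPoint 3 (fun i => ((k * m : ℕ) : ℤ) * x i) /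
      criticalTwoPoint 3 (fun i => ((m : ℕ) : ℤ) * x i)) atTop (𝓝 ((k : ℝ) ^ (-a)))

/-- `(c xᵢ)ᵢ = c e₀` for `x = e₀`. [folklore] -/
theorem intMul_single_one (c : ℤ) :
    (fun i => c * (Pi.single (0 : Fin 3) (1 : ℤ) : Site 3) i) = Pi.single 0 c := by
  funext i
  by_cases hi : i = 0
  · subst hi; simp
  · simp [Pi.single_eq_of_ne hi]

/-! ### The window `1 ≤ a ≤ 2` -/

/-- **The exponent of ray regular variation lies in the rigorous window**: `1 ≤ a ≤ 2`, i.e.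
`Δ = a/2 ∈ [1/2, 1]`. Iterating the axis doubling ratio `g(2m)/g(m) → 2^{-a}` from one large scale
`N` gives `g(2^j N) ≷ q^j g(N)`, which the window `c m⁻² ≤ g(m) ≤ C m⁻¹`
(`criticalTwoPoint_bounds_holds`: Simon–Lieb and the infrared bound) caps at `2q ≤ 1 ≤ 4q`.
[cite: DuminilCopinICM2022, §8.1] -/
theorem exponent_mem_Icc_of_rayRV {a : ℝ} (hRV : RayRV[a]) : 1 ≤ a ∧ a ≤ 2 := by
  set g : ℕ → ℝ := fun m => criticalTwoPoint 3 (Pi.single 0 (m : ℤ)) with hg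
  have hgpos : ∀ m, 0 < g m := fun m => PinnedClusterPoints.criticalTwoPoint_pos3 _
  -- the axis doubling ratio
  have he : (Pi.single (0 : Fin 3) (1 : ℤ) : Site 3) ≠ 0 := by
    intro h
    have := congr_fun h 0
    simp at this
  have hratio : Tendsto (fun m : ℕ => g (2 * m) / g m) atTop (𝓝 ((2:ℝ) ^ (-a))) := by
    have h := hRV (Pi.single 0 1) he 2 (by norm_num)
    have h2r : (((2:ℕ) : ℝ)) = (2:ℝ) := by norm_num
    rw [h2r] at h
    refine h.congr fun m => ?_
    simp only [hg, intMul_single_one]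
  -- the two-point window on the axis
  obtain ⟨c, hc, hlow⟩ := criticalTwoPoint_axis_sq_lower
  obtain ⟨c', C, -, hbd⟩ := criticalTwoPoint_bounds_holds (d := 3) le_rfl
  have hupp : ∀ m : ℕ, 1 ≤ m → g m ≤ C / (m : ℝ) := by
    intro m hm
    have hm0 : (0 : ℝ) < m := by exact_mod_cast hm
    have hx : (Pi.single 0 (m : ℤ) : Site 3) ≠ 0 := by
      intro h0
      have := congr_fun h0 0
      simp only [Pi.single_eq_same, Pi.zero_apply] at this
      omega
    have h1 := (hbd _ hx).2
    rw [norm_single_axis, Int.cast_natCast, abs_of_pos hm0,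
      show (-(((3 : ℕ) : ℝ) - 2)) = -(1 : ℝ) by norm_num, Real.rpow_neg_one,
      ← div_eq_mul_inv] at h1
    exact h1
  -- iteration of a ratio bound from one scale
  have iter_ge : ∀ {q : ℝ} {N : ℕ}, 0 ≤ q → (∀ m, N ≤ m → q * g m ≤ g (2 * m)) →
      ∀ j : ℕ, q ^ j * g N ≤ g (2 ^ j * N) := by
    intro q N hq h j
    induction j with
    | zero => simp
    | succ j ih =>
      have hle : N ≤ 2 ^ j * N := Nat.le_mul_of_pos_left N (pow_pos two_pos j)
      calc q ^ (j + 1) * g N = q * (q ^ j * g N) := by ring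
        _ ≤ q * g (2 ^ j * N) := mul_le_mul_of_nonneg_left ih hq
        _ ≤ g (2 * (2 ^ j * N)) := h _ hle
        _ = g (2 ^ (j + 1) * N) := by rw [pow_succ]; ring_nf
  have iter_le : ∀ {q : ℝ} {N : ℕ}, 0 ≤ q → (∀ m, N ≤ m → g (2 * m) ≤ q * g m) →
      ∀ j : ℕ, g (2 ^ j * N) ≤ q ^ j * g N := by
    intro q N hq h j
    induction j with
    | zero => simp
    | succ j ih =>
      have hle : N ≤ 2 ^ j * N := Nat.le_mul_of_pos_left N (pow_pos two_pos j)
      calc g (2 ^ (j + 1) * N) = g (2 * (2 ^ j * N)) := by rw [pow_succ]; ring_nf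
        _ ≤ q * g (2 ^ j * N) := h _ hle
        _ ≤ q * (q ^ j * g N) := mul_le_mul_of_nonneg_left ih hq
        _ = q ^ (j + 1) * g N := by ring
  constructor
  · -- `a ≥ 1`: otherwise `2^{-a} > 1/2` and `g(2^j N) ≥ q^j g(N)` with `2q > 1` beats `g ≤ C/m`
    by_contra ha
    push Not at ha
    have hL : (1:ℝ) / 2 < (2:ℝ) ^ (-a) := by
      rw [show (1:ℝ) / 2 = (2:ℝ) ^ (-(1:ℝ)) by norm_num]
      exact Real.rpow_lt_rpow_of_exponent_lt one_lt_two (by linarith)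
    obtain ⟨q, hq1, hq2⟩ := exists_between hL
    have hqpos : 0 < q := lt_trans (by norm_num) hq1
    have hev : ∀ᶠ m in atTop, q < g (2 * m) / g m := hratio.eventually (lt_mem_nhds hq2)
    obtain ⟨N₀, hN₀⟩ := eventually_atTop.1 hev
    set N := max N₀ 1 with hN
    have hN1 : 1 ≤ N := le_max_right _ _
    have hstep : ∀ m, N ≤ m → q * g m ≤ g (2 * m) := fun m hm =>
      ((lt_div_iff₀ (hgpos m)).1 (hN₀ m ((le_max_left _ _).trans hm))).le
    -- `(2q)^j ≤ C / (N g N)` for all `j`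
    have hbound : ∀ j : ℕ, (2 * q) ^ j ≤ C / ((N : ℝ) * g N) := by
      intro j
      have h1 := iter_ge hqpos.le hstep j
      have h2 := hupp (2 ^ j * N) (Nat.le_mul_of_pos_left N (pow_pos two_pos j) |>.trans' hN1)
      have hNg : 0 < (N : ℝ) * g N := mul_pos (by exact_mod_cast hN1) (hgpos N)
      rw [le_div_iff₀ hNg]
      have h3 : q ^ j * g N ≤ C / ((2 ^ j * N : ℕ) : ℝ) := h1.trans h2
      have h4 : (0:ℝ) < ((2 ^ j * N : ℕ) : ℝ) := by positivity
      rw [le_div_iff₀ h4] at h3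
      calc (2 * q) ^ j * ((N : ℝ) * g N) = q ^ j * g N * ((2 ^ j * N : ℕ) : ℝ) := by
            push_cast; ring
        _ ≤ C := h3
    have hdiv : Tendsto (fun j : ℕ => (2 * q) ^ j) atTop atTop :=
      tendsto_pow_atTop_atTop_of_one_lt (by linarith)
    obtain ⟨j, hj⟩ := (hdiv.eventually_gt_atTop (C / ((N : ℝ) * g N))).exists
    exact absurd (hbound j) (not_le.2 hj)
  · -- `a ≤ 2`: otherwise `2^{-a} < 1/4` and `g(2^j N) ≤ q^j g(N)` with `4q < 1` beats `g ≥ c/m²`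
    by_contra ha
    push Not at ha
    have hL : (2:ℝ) ^ (-a) < 1 / 4 := by
      rw [show (1:ℝ) / 4 = (2:ℝ) ^ (-(2:ℝ)) by norm_num]
      exact Real.rpow_lt_rpow_of_exponent_lt one_lt_two (by linarith)
    have hLpos : 0 < (2:ℝ) ^ (-a) := Real.rpow_pos_of_pos two_pos _
    obtain ⟨q, hq1, hq2⟩ := exists_between hL
    have hqpos : 0 < q := hLpos.trans hq1
    have hev : ∀ᶠ m in atTop, g (2 * m) / g m < q := hratio.eventually (gt_mem_nhds hq1)
    obtain ⟨N₀, hN₀⟩ := eventually_atTop.1 hev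
    set N := max N₀ 1 with hN
    have hN1 : 1 ≤ N := le_max_right _ _
    have hstep : ∀ m, N ≤ m → g (2 * m) ≤ q * g m := fun m hm =>
      ((div_lt_iff₀ (hgpos m)).1 (hN₀ m ((le_max_left _ _).trans hm))).le
    -- `c / (N² g N) ≤ (4q)^j` for all `j`
    have hbound : ∀ j : ℕ, c / ((N : ℝ) ^ 2 * g N) ≤ (4 * q) ^ j := by
      intro j
      have h1 := iter_le hqpos.le hstep j
      have h2 := hlow (2 ^ j * N) (Nat.le_mul_of_pos_left N (pow_pos two_pos j) |>.trans' hN1)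
      have hNg : 0 < (N : ℝ) ^ 2 * g N := mul_pos (by positivity) (hgpos N)
      rw [div_le_iff₀ hNg]
      have h3 : c / ((2 ^ j * N : ℕ) : ℝ) ^ 2 ≤ q ^ j * g N := h2.trans h1
      have h4 : (0:ℝ) < ((2 ^ j * N : ℕ) : ℝ) ^ 2 := by positivity
      rw [div_le_iff₀ h4] at h3
      calc c ≤ q ^ j * g N * ((2 ^ j * N : ℕ) : ℝ) ^ 2 := h3
        _ = (4 * q) ^ j * ((N : ℝ) ^ 2 * g N) := by
            push_cast
            rw [mul_pow, mul_pow, ← pow_mul, show (2:ℝ) ^ (j * 2) = 4 ^ j by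
              rw [mul_comm, pow_mul]; norm_num]
            ring
    have hdiv : Tendsto (fun j : ℕ => (4 * q) ^ j) atTop (𝓝 0) :=
      tendsto_pow_atTop_nhds_zero_of_lt_one (by linarith) (by linarith)
    have hcpos : 0 < c / ((N : ℝ) ^ 2 * g N) := div_pos hc (mul_pos (by positivity) (hgpos N))
    obtain ⟨j, hj⟩ := (hdiv.eventually (gt_mem_nhds hcpos)).exists
    exact absurd (hbound j) (not_le.2 hj)


end Summit.CriticalPhenomena.Ising3DConformalLimit.HarmonicMomentsIsotropyTwoPoint.RayRV

end
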